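import Literature.NumberTheory.Sieve.PolynomialValuesSieveBounds
import Literature.NumberTheory.Sieve.PolynomialValuesPrimeDecomposition
import Literature.Barriers.Parity.SiegelZeroQuadraticPolynomialsTools
import HarnessLib

/-!
# Granville–Mollin's Theorem 4: the sieve decomposition (6.1) for `f_d = x² + x + (1 + q)/4`

Topic `Literature/Barriers/Parity`, sieve-theoretic layer of the proof of
`Literature.Barriers.Parity.GranvilleMollin2000_thm4` (Granville–Mollin, *Rabinowitsch revisited*,
Acta Arith. 96 (2000), Theorem 4), specialising the general polynomial-values sieve of
`Literature/NumberTheory/Sieve/PolynomialValuesSieveSequence.lean`, `…SieveBounds.lean`,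
`…PrimeDecomposition.lean` to the Euler–Rabinowitsch polynomial `f_d`, `d = −q`, `q ≡ 3 (mod 8)`
(`ω(2) = 0`, `ω(p) = 1 + (p/q) ≤ 2`, `SiegelZeroQuadraticPolynomialsTools.lean`). Everything is
PROVED; no definition is introduced. Notation: `V(z) = ∏_{p<z} (1 − ω(p)/p)`,
`P(y) = ∏_{p<y} p`, `Kω = 2e^{17+12/log 2}`, `Cω = flConst 2 Kω`.

* Values: `f_d(n) = n² + n + (1+q)/4 ≥ n²`, `≥ 2` (`q ≥ 7`), `≤ 2N²` for `n ≤ N`, `q ≤ N`, `N ≥ 2`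
  (`rabinowitsch_sq_le_eval`, `rabinowitsch_two_le_natAbs`, `rabinowitsch_eval_le`).
* `rabinowitsch_abs_card_coprime_sub_le` — main term of (6.1):
  `|#{1 ≤ n ≤ N : (f(n), P(y)) = 1} − N V(y)| ≤ Cω N V(y) e^{−log √N/log y} + √N e⁸ log² y`
  (`2 ≤ y ≤ √N`).
* `rabinowitsch_card_apIndex_coprime_le` — the progressions of (6.1): for a prime `q' ≥ y` and
  `2 ≤ z ≤ y`, `z ≤ √(N/q')`: `#{n ∈ apIndex N q' r : (f(n), P(y)) = 1} ≤ (1 + Cω)(N/q') V(z) +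
  √(N/q') e⁸ log² z`; and the trivial `≤ N/q' + 1` (`card_apIndex_filter_le`).
* `rabinowitsch_polyPrimeCount_le`, `rabinowitsch_card_coprime_le` — the two directions of (6.1):
  `π_f(N) ≤ S + √y + 1` and `S ≤ π_f(N) + ∑_{y ≤ q' ≤ √2 N} ∑_{r} #{n ∈ apIndex N q' r : (f(n), P(y)) = 1}`
  with `S = #{1 ≤ n ≤ N : (f(n), P(y)) = 1}` and `r` over the roots of `f` mod `q'`.
* `sum_roots_le_mul` — `∑_{r root mod q'} T(r) ≤ ω(q') B` when each `T(r) ≤ B`.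

[cite: GranvilleMollin2000, §6A (6.1) and §6B]
-/

noncomputable section

open Finset Real Polynomial
open Literature.NumberTheory.Sieve

namespace Literature.Barriers.Parity

/-! ### The values of `f_d`, `d = −q` -/

/-- `f_d(n) = n² + n + (1 + q)/4` for `d = −q`. [folklore] -/
theorem rabinowitsch_eval_eq {d : ℤ} {q : ℕ} (hdq : d = -(q : ℤ)) (n : ℕ) :
    (rabinowitschPoly d).eval (n : ℤ) = (n : ℤ) ^ 2 + n + (1 + (q : ℤ)) / 4 := by
  rw [rabinowitschPoly_eval, hdq, sub_neg_eq_add]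

/-- `f_d(n) ≥ n²` (`q ≥ 0`). [folklore] -/
theorem rabinowitsch_sq_le_eval {d : ℤ} {q : ℕ} (hdq : d = -(q : ℤ)) (n : ℕ) :
    ((n : ℤ)) ^ 2 ≤ (rabinowitschPoly d).eval (n : ℤ) := by
  rw [rabinowitsch_eval_eq hdq]
  have h : (0 : ℤ) ≤ (1 + (q : ℤ)) / 4 := Int.ediv_nonneg (by positivity) (by norm_num)
  have hn : (0 : ℤ) ≤ n := by positivity
  linarith

/-- `f_d(n) > 0` for `d = −q`, `q ≥ 3`. [folklore] -/
theorem rabinowitsch_eval_pos {d : ℤ} {q : ℕ} (hdq : d = -(q : ℤ)) (hq : 3 ≤ q) (n : ℕ) :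
    0 < (rabinowitschPoly d).eval (n : ℤ) :=
  rabinowitschPoly_eval_pos (by rw [hdq]; omega) n

/-- `|f_d(n)| ≥ 2` for `q ≥ 7`. [folklore] -/
theorem rabinowitsch_two_le_natAbs {d : ℤ} {q : ℕ} (hdq : d = -(q : ℤ)) (hq : 7 ≤ q) (n : ℕ) :
    2 ≤ ((rabinowitschPoly d).eval (n : ℤ)).natAbs := by
  have h : (2 : ℤ) ≤ (rabinowitschPoly d).eval (n : ℤ) := by
    rw [rabinowitsch_eval_eq hdq]
    have h1 : (2 : ℤ) ≤ (1 + (q : ℤ)) / 4 := Int.le_ediv_of_mul_le (by norm_num) (by omega)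
    have hn : (0 : ℤ) ≤ (n : ℤ) ^ 2 + n := by positivity
    linarith
  have h0 : 0 ≤ (rabinowitschPoly d).eval (n : ℤ) := by linarith
  have : ((((rabinowitschPoly d).eval (n : ℤ)).natAbs : ℕ) : ℤ) = (rabinowitschPoly d).eval (n : ℤ) :=
    Int.natAbs_of_nonneg h0
  omega

/-- `f_d(n) ≤ 2N²` for `n ≤ N`, `q ≤ N`, `N ≥ 2`. [folklore] -/
theorem rabinowitsch_eval_le {d : ℤ} {q : ℕ} (hdq : d = -(q : ℤ)) {N n : ℕ} (hn : n ≤ N)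
    (hqN : q ≤ N) (hN : 2 ≤ N) :
    (((rabinowitschPoly d).eval (n : ℤ) : ℤ) : ℝ) ≤ 2 * (N : ℝ) ^ 2 := by
  have h : (rabinowitschPoly d).eval (n : ℤ) ≤ 2 * (N : ℤ) ^ 2 := by
    rw [rabinowitsch_eval_eq hdq]
    have h1 : (1 + (q : ℤ)) / 4 * 4 ≤ (1 + (q : ℤ)) := Int.ediv_mul_le _ (by norm_num)
    have hn' : (n : ℤ) ≤ N := by exact_mod_cast hn
    have hq' : (q : ℤ) ≤ N := by exact_mod_cast hqN
    have hN' : (2 : ℤ) ≤ N := by exact_mod_cast hN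
    have hn0 : (0 : ℤ) ≤ n := by positivity
    have hsq : (n : ℤ) ^ 2 ≤ (N : ℤ) ^ 2 := pow_le_pow_left₀ hn0 hn' 2
    have hNN : 2 * (N : ℤ) ≤ (N : ℤ) ^ 2 := by nlinarith
    nlinarith
  exact_mod_cast h

/-- The standing hypothesis of the sieve lemmas for `f_d` on any index set inside `(0, N]`:
`0 < f_d(n) ≤ 2N²`. [folklore] -/
theorem rabinowitsch_hx {d : ℤ} {q : ℕ} (hdq : d = -(q : ℤ)) (hq : 3 ≤ q) {N : ℕ} (hqN : q ≤ N)
    (hN : 2 ≤ N) {S : Finset ℕ} (hS : S ⊆ Ioc 0 N) :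
    ∀ n ∈ S, 0 < (rabinowitschPoly d).eval (n : ℤ) ∧
      (((rabinowitschPoly d).eval (n : ℤ) : ℤ) : ℝ) ≤ 2 * (N : ℝ) ^ 2 := fun n hn =>
  ⟨rabinowitsch_eval_pos hdq hq n, rabinowitsch_eval_le hdq (Finset.mem_Ioc.mp (hS hn)).2 hqN hN⟩

/-- `ω(2) ≤ 1` and `ω(p) ≤ 2` for `f_d`, `q ≡ 3 (mod 8)` (the hypotheses of the dimension-`2`
sieve bounds). [folklore] -/
theorem rabinowitsch_omega_hyps {d : ℤ} {q : ℕ} (hdq : d = -(q : ℤ)) (hq8 : q % 8 = 3) :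
    polyRootCountMod ![rabinowitschPoly d] 2 ≤ 1 ∧
      ∀ p : ℕ, p.Prime → polyRootCountMod ![rabinowitschPoly d] p ≤ 2 :=
  ⟨by rw [polyRootCountMod_rabinowitschPoly_two_eq_zero hdq hq8]; exact zero_le_one,
    fun _ hp => polyRootCountMod_rabinowitschPoly_le_two hdq (by omega) hp⟩

/-! ### The main term of (6.1) -/

/-- **Main term of (6.1) for `f_d`**: for `q ≡ 3 (mod 8)`, `q ≤ N`, `2 ≤ y ≤ √N`,
`|#{1 ≤ n ≤ N : (f_d(n), P(y)) = 1} − N V(y)| ≤ Cω N V(y) e^{−log √N / log y} + √N e⁸ log² y`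
(the tree's Fundamental Lemma at level `D = √N`). [cite: GranvilleMollin2000, §6A (6.1)] -/
theorem rabinowitsch_abs_card_coprime_sub_le {d : ℤ} {q : ℕ} (hdq : d = -(q : ℤ)) (hq8 : q % 8 = 3)
    {N : ℕ} (hqN : q ≤ N) {y : ℝ} (hy : 2 ≤ y) (hyN : y ≤ Real.sqrt N) :
    |(#((Ioc 0 N).filter fun n : ℕ =>
          ((rabinowitschPoly d).eval (n : ℤ)).natAbs.Coprime (primesProdBelow y)) : ℝ) -
        N * ∏ p ∈ Nat.primesBelow ⌈y⌉₊, (1 - (polyRootCountMod ![rabinowitschPoly d] p : ℝ) / p)| ≤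
      SieveSequence.flConst 2 (2 * Real.exp (17 + 12 / Real.log 2)) * N *
          (∏ p ∈ Nat.primesBelow ⌈y⌉₊, (1 - (polyRootCountMod ![rabinowitschPoly d] p : ℝ) / p)) *
          Real.exp (-(Real.log (Real.sqrt N) / Real.log y)) +
        Real.sqrt N * (Real.exp 8 * Real.log y ^ 2) := by
  have hq3 : 3 ≤ q := by omega
  have hN : 2 ≤ N := by
    have h4 : (2 : ℝ) ≤ Real.sqrt N := hy.trans hyN
    have h4' : (4 : ℝ) ≤ N := by nlinarith [Real.sq_sqrt (Nat.cast_nonneg N), Real.sqrt_nonneg (N : ℝ)]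
    exact_mod_cast (show (2 : ℝ) ≤ N by linarith)
  obtain ⟨h2, hle⟩ := rabinowitsch_omega_hyps hdq hq8
  exact abs_card_coprime_sub_le h2 hle hy hyN (rabinowitsch_hx hdq hq3 hqN hN subset_rfl)

/-! ### The progressions of (6.1) -/

/-- **The progressions of (6.1) for `f_d`**: for `q ≡ 3 (mod 8)`, `q ≤ N`, `N ≥ 2`, a prime
`q' ≥ y` and `2 ≤ z ≤ y`, `z ≤ √(N/q')`:
`#{n ∈ apIndex N q' r : (f_d(n), P(y)) = 1} ≤ (1 + Cω)(N/q') V(z) + √(N/q') e⁸ log² z`.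
[cite: GranvilleMollin2000, §6A (6.1) and §6B] -/
theorem rabinowitsch_card_apIndex_coprime_le {d : ℤ} {q : ℕ} (hdq : d = -(q : ℤ)) (hq8 : q % 8 = 3)
    {N q' r : ℕ} (hq' : q'.Prime) (hqN : q ≤ N) (hN : 2 ≤ N) {y z : ℝ} (hz : 2 ≤ z) (hzy : z ≤ y)
    (hyq' : y ≤ q') (hzX : z ≤ Real.sqrt ((N : ℝ) / q')) :
    (#((apIndex N q' r).filter fun n : ℕ =>
        ((rabinowitschPoly d).eval (n : ℤ)).natAbs.Coprime (primesProdBelow y)) : ℝ) ≤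
      (1 + SieveSequence.flConst 2 (2 * Real.exp (17 + 12 / Real.log 2))) * ((N : ℝ) / q') *
          ∏ p ∈ Nat.primesBelow ⌈z⌉₊, (1 - (polyRootCountMod ![rabinowitschPoly d] p : ℝ) / p) +
        Real.sqrt ((N : ℝ) / q') * (Real.exp 8 * Real.log z ^ 2) := by
  have hq3 : 3 ≤ q := by omega
  obtain ⟨h2, hle⟩ := rabinowitsch_omega_hyps hdq hq8
  have hqz : ∀ p : ℕ, p.Prime → (p : ℝ) < z → ¬ p ∣ q' := by
    intro p hp hpz hpq
    have hpq' : p = q' := (Nat.prime_dvd_prime_iff_eq hp hq').mp hpq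
    have : (p : ℝ) < q' := lt_of_lt_of_le hpz (hzy.trans hyq')
    rw [hpq'] at this
    exact lt_irrefl _ this
  exact card_apIndex_coprime_le_of_le h2 hle hq'.pos hz hzX hzy hqz
    (rabinowitsch_hx hdq hq3 hqN hN (apIndex_subset N q' r))

/-- The trivial bound for a progression: `#{n ∈ apIndex N q' r : …} ≤ N/q' + 1`. [folklore] -/
theorem card_apIndex_filter_le {N q' : ℕ} (hq' : 0 < q') (r : ℕ) (Q : ℕ → Prop) [DecidablePred Q] :
    (#((apIndex N q' r).filter Q) : ℝ) ≤ (N : ℝ) / q' + 1 :=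
  le_trans (by exact_mod_cast Finset.card_filter_le _ _) (card_apIndex_le hq' N r)

/-- Summing a uniform bound over the roots of `f` mod `q'`: `∑_{r mod q', q' ∣ f(r)} T(r) ≤ ω_f(q') B`.
[folklore] -/
theorem sum_roots_le_mul (f : ℤ[X]) {q' : ℕ} {T : ℕ → ℝ} {B : ℝ}
    (hT : ∀ r ∈ (range q').filter (fun r : ℕ => (q' : ℤ) ∣ f.eval (r : ℤ)), T r ≤ B) :
    ∑ r ∈ (range q').filter (fun r : ℕ => (q' : ℤ) ∣ f.eval (r : ℤ)), T r ≤
      (polyRootCountMod ![f] q' : ℝ) * B := by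
  rw [← card_filter_dvd_eval_eq_polyRootCountMod f q']
  calc ∑ r ∈ (range q').filter (fun r : ℕ => (q' : ℤ) ∣ f.eval (r : ℤ)), T r
      ≤ ∑ _r ∈ (range q').filter (fun r : ℕ => (q' : ℤ) ∣ f.eval (r : ℤ)), B := Finset.sum_le_sum hT
    _ = _ := by rw [Finset.sum_const, nsmul_eq_mul]

/-! ### The two directions of (6.1) -/

/-- **(6.1), upper direction**: `π_{f_d}(N) ≤ #{1 ≤ n ≤ N : (f_d(n), P(y)) = 1} + √y + 1`
(prime values are rough, or `< y` — at most `√y` of them since `f_d(n) ≥ n²` — or `n = 0`).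
[cite: GranvilleMollin2000, §6A (6.1)] -/
theorem rabinowitsch_polyPrimeCount_le {d : ℤ} {q : ℕ} (hdq : d = -(q : ℤ)) (hq : 3 ≤ q) (N : ℕ)
    (y : ℝ) :
    (polyPrimeCount ![rabinowitschPoly d] N : ℝ) ≤
      #((Ioc 0 N).filter fun n : ℕ =>
          ((rabinowitschPoly d).eval (n : ℤ)).natAbs.Coprime (primesProdBelow y)) +
        Real.sqrt y + 1 := by
  have hpos := rabinowitsch_eval_pos hdq hq
  have h1 := polyPrimeCount_single_le_card_add_one (rabinowitschPoly d) hpos N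
  have h2 := card_prime_le_card_coprime_add (rabinowitschPoly d) N y
  have h3 := card_natAbs_lt_le_sqrt (rabinowitschPoly d) N y (rabinowitsch_sq_le_eval hdq)
  have h1' : (polyPrimeCount ![rabinowitschPoly d] N : ℝ) ≤
      #((Ioc 0 N).filter fun n : ℕ => ((rabinowitschPoly d).eval (n : ℤ)).natAbs.Prime) + 1 := by
    exact_mod_cast h1
  have h2' : (#((Ioc 0 N).filter fun n : ℕ => ((rabinowitschPoly d).eval (n : ℤ)).natAbs.Prime) : ℝ) ≤
      #((Ioc 0 N).filter fun n : ℕ =>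
          ((rabinowitschPoly d).eval (n : ℤ)).natAbs.Coprime (primesProdBelow y)) +
        #((Ioc 0 N).filter fun n : ℕ =>
          ((((rabinowitschPoly d).eval (n : ℤ)).natAbs : ℕ) : ℝ) < y) := by
    exact_mod_cast h2
  linarith

/-- **(6.1), lower direction**: for `q ≥ 7`, `q ≤ N`, `N ≥ 2`,
`#{1 ≤ n ≤ N : (f_d(n), P(y)) = 1} ≤ π_{f_d}(N) + ∑_{q' prime, ⌈y⌉ ≤ q' ≤ ⌊√2 N⌋} ∑_{r root mod q'}
#{n ∈ apIndex N q' r : (f_d(n), P(y)) = 1}` (a rough composite value `≤ 2N²` has its least prime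
factor `q' ∈ [y, √2 N]`). [cite: GranvilleMollin2000, §6A (6.1)] -/
theorem rabinowitsch_card_coprime_le {d : ℤ} {q : ℕ} (hdq : d = -(q : ℤ)) (hq : 7 ≤ q) {N : ℕ}
    (hqN : q ≤ N) (hN : 2 ≤ N) (y : ℝ) :
    (#((Ioc 0 N).filter fun n : ℕ =>
        ((rabinowitschPoly d).eval (n : ℤ)).natAbs.Coprime (primesProdBelow y)) : ℝ) ≤
      polyPrimeCount ![rabinowitschPoly d] N +
        ∑ q' ∈ (Nat.primesLE ⌊Real.sqrt 2 * N⌋₊).filter (fun q' => ⌈y⌉₊ ≤ q'),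
          ∑ r ∈ (range q').filter (fun r : ℕ => (q' : ℤ) ∣ (rabinowitschPoly d).eval (r : ℤ)),
            (#((apIndex N q' r).filter fun n : ℕ =>
              ((rabinowitschPoly d).eval (n : ℤ)).natAbs.Coprime (primesProdBelow y)) : ℝ) := by
  have hq3 : 3 ≤ q := by omega
  have hpos := rabinowitsch_eval_pos hdq hq3
  have hval : ∀ n ∈ Ioc 0 N, 2 ≤ ((rabinowitschPoly d).eval (n : ℤ)).natAbs ∧
      ((((rabinowitschPoly d).eval (n : ℤ)).natAbs : ℕ) : ℝ) ≤ (Real.sqrt 2 * N) ^ 2 := by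
    intro n hn
    refine ⟨rabinowitsch_two_le_natAbs hdq hq n, ?_⟩
    have hle := rabinowitsch_eval_le hdq (Finset.mem_Ioc.mp hn).2 hqN hN
    have h0 : 0 ≤ (rabinowitschPoly d).eval (n : ℤ) := (hpos n).le
    have hcast : ((((rabinowitschPoly d).eval (n : ℤ)).natAbs : ℕ) : ℝ) =
        (((rabinowitschPoly d).eval (n : ℤ) : ℤ) : ℝ) := by
      rw [← Int.cast_natCast, Int.natAbs_of_nonneg h0]
    rw [hcast, mul_pow, Real.sq_sqrt (by norm_num)]
    exact hle
  have h1 := card_coprime_le_card_prime_add_sum (rabinowitschPoly d) N (y := y)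
    (by positivity : (0 : ℝ) ≤ Real.sqrt 2 * N) hval
  have h2 := card_le_polyPrimeCount_single (rabinowitschPoly d) hpos N
  have h1' : (#((Ioc 0 N).filter fun n : ℕ =>
      ((rabinowitschPoly d).eval (n : ℤ)).natAbs.Coprime (primesProdBelow y)) : ℝ) ≤
      #((Ioc 0 N).filter fun n : ℕ => ((rabinowitschPoly d).eval (n : ℤ)).natAbs.Prime) +
        ∑ q' ∈ (Nat.primesLE ⌊Real.sqrt 2 * N⌋₊).filter (fun q' => ⌈y⌉₊ ≤ q'),
          (#((Ioc 0 N).filter fun n : ℕ => (q' : ℤ) ∣ (rabinowitschPoly d).eval (n : ℤ) ∧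
            ((rabinowitschPoly d).eval (n : ℤ)).natAbs.Coprime (primesProdBelow y)) : ℝ) := by
    exact_mod_cast h1
  have h2' : (#((Ioc 0 N).filter fun n : ℕ => ((rabinowitschPoly d).eval (n : ℤ)).natAbs.Prime) : ℝ) ≤
      polyPrimeCount ![rabinowitschPoly d] N := by exact_mod_cast h2
  have h3 : ∀ q' ∈ (Nat.primesLE ⌊Real.sqrt 2 * N⌋₊).filter (fun q' => ⌈y⌉₊ ≤ q'),
      (#((Ioc 0 N).filter fun n : ℕ => (q' : ℤ) ∣ (rabinowitschPoly d).eval (n : ℤ) ∧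
          ((rabinowitschPoly d).eval (n : ℤ)).natAbs.Coprime (primesProdBelow y)) : ℝ) =
        ∑ r ∈ (range q').filter (fun r : ℕ => (q' : ℤ) ∣ (rabinowitschPoly d).eval (r : ℤ)),
          (#((apIndex N q' r).filter fun n : ℕ =>
            ((rabinowitschPoly d).eval (n : ℤ)).natAbs.Coprime (primesProdBelow y)) : ℝ) := by
    intro q' hq'
    have hprime := Nat.prime_of_mem_primesLE (Finset.mem_filter.mp hq').1
    rw [card_dvd_coprime_eq_sum_apIndex (rabinowitschPoly d) N hprime.pos y]
    push_cast
    rfl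
  rw [← Finset.sum_congr rfl h3]
  linarith

end Literature.Barriers.Parity
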